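import Literature.Computability.AlgebraicComplexity.AsymptoticSpectrumDuality
import Literature.Computability.AlgebraicComplexity.DegenerationSpectralMonotone
import Literature.Computability.AlgebraicComplexity.MatMulMonomialSubrankAsymptotics
import Literature.Computability.AlgebraicComplexity.AsymptoticRankMatMul
import Literature.Computability.AlgebraicComplexity.SchoenhageTauDischarge
import Literature.Computability.AlgebraicComplexity.TensorRestrictionRank
import Literature.Computability.AlgebraicComplexity.BorderRankCW
import Literature.Computability.AlgebraicComplexity.AlmanLi2026IteratedCW
import Mathlib.Analysis.SpecialFunctions.Log.Base

/-!
# Strassen calculus for one-slice tensors, in the kernel: the scalar form of the Alman–Li iterated identity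

Soloist file (summit-directed ideation tier, informed mode), door D1 of the summit
(`omega_le_two_of_cw_two`: `R̃(cw₂) = 3 ⟹ ω = 2`), upper half. Companion of
`SoloInformedCwTwoSpeedup.lean`, which evaluates the scalar form numerically (`R̃(cw₂) ≤ 3.9235` at
`n = 3`, `≤ 3.9309` at `n = 4`).

Alman–Li (arXiv:2605.21738, §7.1; the named fact `AlmanLi2026_iteratedSpeedup_cw`) give, for every
`n` with `2·3^n < 4^n` and `t = 4^n + 2^n − 2·3^n`, the degeneration
`cw₂^{⊠2n} ⊕ ⟨2⟩ ⊠ cw₂^{⊠n} ⊠ ⟨1,t,1⟩ ⊕ ⟨1, t² + 2·3^{2n}, 1⟩ ⊴ (⟨4^n⟩ ⊕ ⟨1,2^n,1⟩)^{⊠2}` (and the same in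
the directions `⟨1,1,·⟩`, `⟨·,1,1⟩`), and conclude by "Strassen calculus". This file PROVES that calculus
for a universal spectral point `F` (`IsUniversalSpectralPoint`):

1. `tensorRestrictsTo_matMulTensor_of_le` (zero padding) and
   `tensorRestrictsTo_sliceProduct_matMulTensor_two`: `⟨2,2,2⟩ ≤ ⟨1,2,1⟩ ⊠ ⟨1,1,2⟩ ⊠ ⟨2,1,1⟩`.
2. `spectralPoint_kroneckerPow_matMulTensor`, `slice₁_pow`/`slice₂_pow`/`slice₃_pow`, `sliceᵢ_mono`:
   the power law `F⟨1,a^L,1⟩ = (F⟨1,a,1⟩)^L` (from the tree's relabellings `⟨k,m,n⟩^{⊠L} ≡ ⟨k^L,m^L,n^L⟩`)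
   and monotonicity in the size, in each of the three directions.
3. `four_le_spectralPoint_matMulTensor_two`: `F⟨2,2,2⟩ ≥ 4` — from the tree's Behrend-type monomial
   restrictions `⟨2,2,2⟩^{⊠L} ≥ ⟨2⟩^{⊠r}`, `r ≥ (2−ε)L`
   (`exists_tensorMonRestrictsTo_kroneckerPow_matMulTensor_unitTensor`) and a limit in `ε`. With item 1
   this is Strassen's `θ₁ + θ₂ + θ₃ ≥ 2` in value form: `F⟨1,2,1⟩ · F⟨1,1,2⟩ · F⟨2,1,1⟩ ≥ 4`.
4. `rpow_logb_le_of_powLaw`: the inequality half of Strassen's parametrisation — for a monotone power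
   law `g` with `g 2 ≥ 1` and `θ := log₂ (g 2)`, `m^θ ≤ g m` for all `m ≥ 1` (sandwich `2^a ≤ m^N < 2^{a+1}`
   and the tree's polynomial-loss discharge `le_of_forall_pow_le_polynomial_mul_pow`).
5. `pow_spectralPoint_cwTensor_two_le_of_iteratedSpeedup`: **the scalar form** — for every `n`, if every
   monotone power law `g ≥ 0` with `g 2 ≤ 2`, `(g 2)³ ≥ 4` (i.e. `θ ∈ [2/3,1]`) and every `X ≥ 0` with
   `X² + 2X·g(t) + g(t² + 2·3^{2n}) ≤ (4^n + g(2^n))²` has `X ≤ B`, then `F(cw₂)^n ≤ B`. (Some direction has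
   `θ ≥ 2/3` by item 3; the identity in that direction is evaluated with `g = F⟨1,·,1⟩` there.)

Trust base: Lean, Mathlib, the tree; item 5 takes the printed identity as the hypothesis `hAL`.
References: arXiv:2605.21738 Prop. 5.1, Thm. 6.2, §7.1 [AlmanLi2026]; V. Strassen, J. reine angew.
Math. 384 (1988) [Strassen1988].
-/

noncomputable section

open scoped BigOperators

namespace Summit.MatrixMultiplication.MatrixMultiplication.Theorems

open Literature.Computability.AlgebraicComplexity

/-! ## Two relabellings of matrix multiplication tensors -/

section Relabel

variable (K : Type) [Field K]

/-- **Zero-padding**: `⟨k',m',n'⟩ ≥ ⟨k,m,n⟩` for `k ≤ k'`, `m ≤ m'`, `n ≤ n'` (restriction along the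
injections `Fin.castLE`). -/
theorem tensorRestrictsTo_matMulTensor_of_le {k m n k' m' n' : ℕ} (hk : k ≤ k') (hm : m ≤ m')
    (hn : n ≤ n') : TensorRestrictsTo (matMulTensor K k' m' n') (matMulTensor K k m n) := by
  have key : matMulTensor K k m n = fun a b c => matMulTensor K k' m' n'
      (Fin.castLE hk a.1, Fin.castLE hn a.2) (Fin.castLE hk b.1, Fin.castLE hm b.2)
      (Fin.castLE hm c.1, Fin.castLE hn c.2) := by
    funext a b c
    simp only [matMulTensor, Fin.castLE_inj]
  rw [key]
  exact tensorRestrictsTo_precomp _ _ _ _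

/-- **`⟨2,2,2⟩ ≤ ⟨1,2,1⟩ ⊗ ⟨1,1,2⟩ ⊗ ⟨2,1,1⟩`**: the matrix multiplication tensor `⟨2,2,2⟩` is a
relabelling of the Kronecker product of the three one-slice tensors of size `2` (one inner product in
each of the three directions). -/
theorem tensorRestrictsTo_sliceProduct_matMulTensor_two :
    TensorRestrictsTo
      (kroneckerTensor (kroneckerTensor (matMulTensor K 1 2 1) (matMulTensor K 1 1 2))
        (matMulTensor K 2 1 1))
      (matMulTensor K 2 2 2) := by
  have key : matMulTensor K 2 2 2 = fun a b c =>
      kroneckerTensor (kroneckerTensor (matMulTensor K 1 2 1) (matMulTensor K 1 1 2))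
        (matMulTensor K 2 1 1)
        (((0, 0), (0, a.2)), (a.1, 0)) (((0, b.2), (0, 0)), (b.1, 0)) (((c.1, 0), (0, c.2)), (0, 0)) := by
    funext a b c
    simp only [kroneckerTensor_apply, matMulTensor, true_and, and_true]
    by_cases h1 : a.1 = b.1 <;> by_cases h2 : b.2 = c.1 <;> by_cases h3 : a.2 = c.2 <;>
      simp [h1, h2, h3]
  rw [key]
  exact tensorRestrictsTo_precomp _ _ _ _

end Relabel

/-! ## Values of a universal spectral point on one-slice tensors -/

section Spectral

variable {F : SpectralMap ℂ} (hF : IsUniversalSpectralPoint ℂ F)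
include hF

/-- `F ⟨r⟩ = r` (solo-local name; cf. the tree's `spectralPoint_unitTensor`). -/
theorem soloSpectralPoint_unitTensor (r : ℕ) : F (unitTensor ℂ r) = r := by
  rw [← TensorClass.evalRingHom_mk hF, ← TensorClass.natCast_eq_mk, map_natCast]

/-- `F (⟨k,m,n⟩^{⊗L}) = F ⟨k^L, m^L, n^L⟩` (the two relabellings of the tree). -/
theorem spectralPoint_kroneckerPow_matMulTensor (k m n L : ℕ) :
    F (kroneckerPow (matMulTensor ℂ k m n) L) = F (matMulTensor ℂ (k ^ L) (m ^ L) (n ^ L)) :=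
  hF.eq_of_restrictsTo (tensorRestrictsTo_matMulTensor_pow_kroneckerPow ℂ k m n L)
    (tensorMonRestrictsTo_kroneckerPow_matMulTensor ℂ k m n L).tensorRestrictsTo

/-- Power law in direction `⟨1,·,1⟩`: `F ⟨1,a^L,1⟩ = (F ⟨1,a,1⟩)^L`. -/
theorem slice₁_pow (a L : ℕ) :
    F (matMulTensor ℂ 1 (a ^ L) 1) = F (matMulTensor ℂ 1 a 1) ^ L := by
  have h := spectralPoint_kroneckerPow_matMulTensor hF 1 a 1 L
  rw [one_pow] at h
  rw [← h, hF.map_kroneckerPow]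

/-- Power law in direction `⟨1,1,·⟩`. -/
theorem slice₂_pow (a L : ℕ) :
    F (matMulTensor ℂ 1 1 (a ^ L)) = F (matMulTensor ℂ 1 1 a) ^ L := by
  have h := spectralPoint_kroneckerPow_matMulTensor hF 1 1 a L
  rw [one_pow] at h
  rw [← h, hF.map_kroneckerPow]

/-- Power law in direction `⟨·,1,1⟩`. -/
theorem slice₃_pow (a L : ℕ) :
    F (matMulTensor ℂ (a ^ L) 1 1) = F (matMulTensor ℂ a 1 1) ^ L := by
  have h := spectralPoint_kroneckerPow_matMulTensor hF a 1 1 L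
  rw [one_pow] at h
  rw [← h, hF.map_kroneckerPow]

/-- Monotonicity in direction `⟨1,·,1⟩`. -/
theorem slice₁_mono {a b : ℕ} (h : a ≤ b) :
    F (matMulTensor ℂ 1 a 1) ≤ F (matMulTensor ℂ 1 b 1) :=
  hF.mono _ _ (tensorRestrictsTo_matMulTensor_of_le ℂ le_rfl h le_rfl)

/-- Monotonicity in direction `⟨1,1,·⟩`. -/
theorem slice₂_mono {a b : ℕ} (h : a ≤ b) :
    F (matMulTensor ℂ 1 1 a) ≤ F (matMulTensor ℂ 1 1 b) :=
  hF.mono _ _ (tensorRestrictsTo_matMulTensor_of_le ℂ le_rfl le_rfl h)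

/-- Monotonicity in direction `⟨·,1,1⟩`. -/
theorem slice₃_mono {a b : ℕ} (h : a ≤ b) :
    F (matMulTensor ℂ a 1 1) ≤ F (matMulTensor ℂ b 1 1) :=
  hF.mono _ _ (tensorRestrictsTo_matMulTensor_of_le ℂ h le_rfl le_rfl)

/-- `F ⟨k,m,n⟩ ≤ k m n` (the rank bound). -/
theorem spectralPoint_matMulTensor_le (k m n : ℕ) :
    F (matMulTensor ℂ k m n) ≤ (k * m * n : ℕ) :=
  (hF.le_tensorRank _).trans (by exact_mod_cast tensorRank_matMulTensor_le ℂ k m n)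

/-- **`θ₁ + θ₂ + θ₃ ≥ 2` in value form: every universal spectral point takes a value `≥ 4` at
`⟨2,2,2⟩`** (Strassen: `Q̃(⟨n,n,n⟩) = n²`; here from the tree's Behrend/Ruzsa–Szemerédi monomial
restrictions `⟨2,2,2⟩^{⊗L} ≥ ⟨2⟩^{⊗r}`, `r ≥ (2-ε)L`). -/
theorem four_le_spectralPoint_matMulTensor_two : 4 ≤ F (matMulTensor ℂ 2 2 2) := by
  set y := F (matMulTensor ℂ 2 2 2) with hy
  have hy0 : 0 ≤ y := hF.nonneg _
  -- evaluation of the Behrend restriction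
  have eval : ∀ {L r : ℕ}, TensorMonRestrictsTo (kroneckerPow (matMulTensor ℂ 2 2 2) L)
      (kroneckerPow (unitTensor ℂ 2) r) → (2 : ℝ) ^ r ≤ y ^ L := by
    intro L r hres
    have h := hF.mono _ _ hres.tensorRestrictsTo
    rw [hF.map_kroneckerPow, hF.map_kroneckerPow, soloSpectralPoint_unitTensor hF] at h
    exact_mod_cast h
  have key : ∀ ε : ℝ, 0 < ε → ε ≤ 1 → (2 : ℝ) ^ (2 - ε) ≤ y := by
    intro ε hε hε1
    obtain ⟨L₀, hL₀⟩ := exists_tensorMonRestrictsTo_kroneckerPow_matMulTensor_unitTensor ℂ hε hε1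
    have hy1 : 1 ≤ y := by
      obtain ⟨r, -, hres⟩ := hL₀ (max L₀ 1) (le_max_left _ _)
      have h1 : (2 : ℝ) ^ r ≤ y ^ (max L₀ 1) := eval hres
      have h2 : (1 : ℝ) ≤ 2 ^ r := one_le_pow₀ (by norm_num)
      by_contra hlt
      push Not at hlt
      have h3 : y ^ (max L₀ 1) < 1 :=
        pow_lt_one₀ hy0 hlt (Nat.pos_iff_ne_zero.1 (lt_of_lt_of_le one_pos (le_max_right _ _)))
      linarith
    refine le_of_forall_pow_le_polynomial_mul_pow _ _ ((4 : ℝ) ^ L₀) 0 hy0 (fun N => ?_)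
    rw [pow_zero, mul_one]
    by_cases hN : L₀ ≤ N
    · obtain ⟨r, hr, hres⟩ := hL₀ N hN
      have h1 : (2 : ℝ) ^ r ≤ y ^ N := eval hres
      have h2 : ((2 : ℝ) ^ (2 - ε)) ^ N ≤ (2 : ℝ) ^ r := by
        rw [← Real.rpow_natCast, ← Real.rpow_mul (by norm_num : (0:ℝ) ≤ 2), ← Real.rpow_natCast 2 r]
        exact Real.rpow_le_rpow_of_exponent_le (by norm_num) hr
      calc ((2 : ℝ) ^ (2 - ε)) ^ N ≤ 2 ^ r := h2
        _ ≤ y ^ N := h1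
        _ ≤ 4 ^ L₀ * y ^ N := le_mul_of_one_le_left (pow_nonneg hy0 N) (one_le_pow₀ (by norm_num))
    · push Not at hN
      have hb : (2 : ℝ) ^ (2 - ε) ≤ 4 := by
        calc (2 : ℝ) ^ (2 - ε) ≤ (2 : ℝ) ^ (2 : ℝ) :=
              Real.rpow_le_rpow_of_exponent_le (by norm_num) (by linarith)
          _ = 4 := by norm_num [Real.rpow_two]
      calc ((2 : ℝ) ^ (2 - ε)) ^ N ≤ (4 : ℝ) ^ N :=
            pow_le_pow_left₀ (Real.rpow_nonneg (by norm_num) _) hb N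
        _ ≤ (4 : ℝ) ^ L₀ := pow_le_pow_right₀ (by norm_num) hN.le
        _ ≤ 4 ^ L₀ * y ^ N := le_mul_of_one_le_right (by positivity) (one_le_pow₀ hy1)
  -- `2^{2-ε} ≤ y` for all small `ε > 0` forces `4 ≤ y`
  by_contra hlt
  push Not at hlt
  have hy2 : 2 ≤ y := by
    have h := key 1 one_pos le_rfl
    norm_num at h
    exact h
  have hypos : 0 < y := by linarith
  set L := Real.logb 2 y with hL
  have hyL : (2 : ℝ) ^ L = y := Real.rpow_logb (by norm_num) (by norm_num) hypos
  have hL2 : L < 2 := by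
    have h : (2 : ℝ) ^ L < (2 : ℝ) ^ (2 : ℝ) := by
      rw [hyL, Real.rpow_two]; norm_num; exact hlt
    exact (Real.rpow_lt_rpow_left_iff one_lt_two).1 h
  have hε : 0 < min 1 ((2 - L) / 2) := lt_min one_pos (by linarith)
  have h := key (min 1 ((2 - L) / 2)) hε (min_le_left _ _)
  have hgt : L < 2 - min 1 ((2 - L) / 2) := by
    have := min_le_right (1 : ℝ) ((2 - L) / 2)
    linarith
  have h' : (2 : ℝ) ^ L < (2 : ℝ) ^ (2 - min 1 ((2 - L) / 2)) :=
    Real.rpow_lt_rpow_of_exponent_lt one_lt_two hgt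
  rw [hyL] at h'
  linarith

end Spectral

/-! ## Strassen's parametrisation, inequality half -/

section Real

/-- **Half of Strassen's parametrisation `F ⟨1,m,1⟩ = m^θ`.** For a function `g : ℕ → ℝ≥0` with
`g (a^L) = (g a)^L`, monotone, and `g 2 ≥ 1`, put `θ = log₂ g 2`; then `m^θ ≤ g m` for every `m ≥ 1`
(sandwich `2^a ≤ m^N < 2^{a+1}`, `N → ∞`). -/
theorem rpow_logb_le_of_powLaw {g : ℕ → ℝ} (hg0 : ∀ m, 0 ≤ g m)
    (hpow : ∀ a L : ℕ, g (a ^ L) = g a ^ L) (hmono : ∀ a b : ℕ, a ≤ b → g a ≤ g b)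
    (h1 : 1 ≤ g 2) {m : ℕ} (hm : 1 ≤ m) : (m : ℝ) ^ Real.logb 2 (g 2) ≤ g m := by
  set θ := Real.logb 2 (g 2) with hθ
  have hθ0 : 0 ≤ θ := Real.logb_nonneg one_lt_two h1
  have hc : (2 : ℝ) ^ θ = g 2 := Real.rpow_logb (by norm_num) (by norm_num) (by linarith)
  have hm0 : (0 : ℝ) ≤ m := Nat.cast_nonneg m
  refine le_of_forall_pow_le_polynomial_mul_pow _ _ (g 2) 0 (hg0 m) (fun N => ?_)
  rw [pow_zero, mul_one]
  have hmN : m ^ N ≠ 0 := pow_ne_zero _ (by omega)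
  set a := Nat.log 2 (m ^ N) with ha
  have h1' : 2 ^ a ≤ m ^ N := Nat.pow_log_le_self 2 hmN
  have h2' : m ^ N < 2 ^ (a + 1) := Nat.lt_pow_succ_log_self one_lt_two _
  have hlow : g 2 ^ a ≤ g m ^ N := by
    rw [← hpow, ← hpow]
    exact hmono _ _ h1'
  have e1 : ((m : ℝ) ^ θ) ^ N = ((m : ℝ) ^ N) ^ θ := by
    rw [← Real.rpow_natCast ((m : ℝ) ^ θ) N, ← Real.rpow_mul hm0, mul_comm, Real.rpow_mul hm0,
      Real.rpow_natCast]
  have e2 : ((2 : ℝ) ^ (a + 1)) ^ θ = g 2 ^ (a + 1) := by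
    rw [← Real.rpow_natCast (2 : ℝ) (a + 1), ← Real.rpow_mul (by norm_num : (0:ℝ) ≤ 2), mul_comm,
      Real.rpow_mul (by norm_num : (0:ℝ) ≤ 2), hc, Real.rpow_natCast]
  have h2R : ((m : ℝ) ^ N) ≤ (2 : ℝ) ^ (a + 1) := by exact_mod_cast h2'.le
  have hup : ((m : ℝ) ^ θ) ^ N ≤ g 2 ^ (a + 1) := by
    rw [e1, ← e2]
    exact Real.rpow_le_rpow (pow_nonneg hm0 N) h2R hθ0
  calc ((m : ℝ) ^ θ) ^ N ≤ g 2 ^ (a + 1) := hup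
    _ = g 2 * g 2 ^ a := by ring
    _ ≤ g 2 * g m ^ N := mul_le_mul_of_nonneg_left hlow (hg0 2)

end Real

/-! ## The scalar form of the iterated identity -/

section Scalar

/-- The value of `F` in direction `⟨1,·,1⟩` as a function of the size. -/
def slice₁ (F : SpectralMap ℂ) (m : ℕ) : ℝ := F (matMulTensor ℂ 1 m 1)
/-- The value of `F` in direction `⟨1,1,·⟩`. -/
def slice₂ (F : SpectralMap ℂ) (m : ℕ) : ℝ := F (matMulTensor ℂ 1 1 m)
/-- The value of `F` in direction `⟨·,1,1⟩`. -/
def slice₃ (F : SpectralMap ℂ) (m : ℕ) : ℝ := F (matMulTensor ℂ m 1 1)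

/-- **The scalar form of the Alman–Li iterated identity.** For every `n ≥ 1` with `2·3^n < 4^n` and
`4^n + 2^n = 2·3^n + t`: if every monotone power law `g ≥ 0` on `ℕ` with `g 2 ≤ 2`, `(g 2)^3 ≥ 4` and
every `X ≥ 0` with `X² + 2X·g(t) + g(t² + 2·3^{2n}) ≤ (4^n + g(2^n))²` satisfy `X ≤ B`, then every
universal spectral point has `F(cw₂)^n ≤ B`. -/
theorem pow_spectralPoint_cwTensor_two_le_of_iteratedSpeedup (hAL : AlmanLi2026_iteratedSpeedup_cw)
    {F : SpectralMap ℂ} (hF : IsUniversalSpectralPoint ℂ F) {n t : ℕ} (hn : 1 ≤ n)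
    (hlt : 2 * (2 + 1) ^ n < (2 + 2) ^ n) (ht : (2 + 2) ^ n + 2 ^ n = 2 * (2 + 1) ^ n + t) {B : ℝ}
    (hnum : ∀ g : ℕ → ℝ, (∀ m, 0 ≤ g m) → (∀ a L : ℕ, g (a ^ L) = g a ^ L) →
      (∀ a b : ℕ, a ≤ b → g a ≤ g b) → g 2 ≤ 2 → 4 ≤ g 2 ^ 3 → ∀ X : ℝ, 0 ≤ X →
      X ^ 2 + 2 * X * g t + g (t ^ 2 + 2 * 3 ^ (2 * n)) ≤ ((4 : ℝ) ^ n + g (2 ^ n)) ^ 2 → X ≤ B) :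
    F (cwTensor ℂ 2) ^ n ≤ B := by
  obtain ⟨h₁, h₂, h₃⟩ := hAL 2 n t le_rfl hn hlt ht
  -- the three identities with `2 + 2 = 4`, `2 + 1 = 3` evaluated
  have h₁' : AlgDegeneratesTo
      (kroneckerTensor (directSumTensor (unitTensor ℂ (4 ^ n)) (matMulTensor ℂ 1 (2 ^ n) 1))
        (directSumTensor (unitTensor ℂ (4 ^ n)) (matMulTensor ℂ 1 (2 ^ n) 1)))
      (directSumTensor (kroneckerPow (cwTensor ℂ 2) (2 * n))
        (directSumTensor (kroneckerTensor (unitTensor ℂ 2)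
          (kroneckerTensor (kroneckerPow (cwTensor ℂ 2) n) (matMulTensor ℂ 1 t 1)))
          (matMulTensor ℂ 1 (t ^ 2 + 2 * 3 ^ (2 * n)) 1))) := h₁
  have h₂' : AlgDegeneratesTo
      (kroneckerTensor (directSumTensor (unitTensor ℂ (4 ^ n)) (matMulTensor ℂ 1 1 (2 ^ n)))
        (directSumTensor (unitTensor ℂ (4 ^ n)) (matMulTensor ℂ 1 1 (2 ^ n))))
      (directSumTensor (kroneckerPow (cwTensor ℂ 2) (2 * n))
        (directSumTensor (kroneckerTensor (unitTensor ℂ 2)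
          (kroneckerTensor (kroneckerPow (cwTensor ℂ 2) n) (matMulTensor ℂ 1 1 t)))
          (matMulTensor ℂ 1 1 (t ^ 2 + 2 * 3 ^ (2 * n))))) := h₂
  have h₃' : AlgDegeneratesTo
      (kroneckerTensor (directSumTensor (unitTensor ℂ (4 ^ n)) (matMulTensor ℂ (2 ^ n) 1 1))
        (directSumTensor (unitTensor ℂ (4 ^ n)) (matMulTensor ℂ (2 ^ n) 1 1)))
      (directSumTensor (kroneckerPow (cwTensor ℂ 2) (2 * n))
        (directSumTensor (kroneckerTensor (unitTensor ℂ 2)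
          (kroneckerTensor (kroneckerPow (cwTensor ℂ 2) n) (matMulTensor ℂ t 1 1)))
          (matMulTensor ℂ (t ^ 2 + 2 * 3 ^ (2 * n)) 1 1))) := h₃
  set x := F (cwTensor ℂ 2) with hx
  have hx0 : 0 ≤ x := hF.nonneg _
  have e : (x ^ n) ^ 2 = x ^ (2 * n) := by rw [← pow_mul, mul_comm]
  -- evaluate `F` on the three identities
  have ev₁ : (x ^ n) ^ 2 + 2 * x ^ n * slice₁ F t + slice₁ F (t ^ 2 + 2 * 3 ^ (2 * n))
      ≤ ((4 : ℝ) ^ n + slice₁ F (2 ^ n)) ^ 2 := by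
    have h := hF.mono_of_algDegeneratesTo h₁'
    simp only [hF.map_kronecker, hF.map_directSum, hF.map_kroneckerPow,
      soloSpectralPoint_unitTensor hF, Nat.cast_pow, Nat.cast_ofNat] at h
    simp only [slice₁]
    rw [e]
    linarith [h]
  have ev₂ : (x ^ n) ^ 2 + 2 * x ^ n * slice₂ F t + slice₂ F (t ^ 2 + 2 * 3 ^ (2 * n))
      ≤ ((4 : ℝ) ^ n + slice₂ F (2 ^ n)) ^ 2 := by
    have h := hF.mono_of_algDegeneratesTo h₂'
    simp only [hF.map_kronecker, hF.map_directSum, hF.map_kroneckerPow,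
      soloSpectralPoint_unitTensor hF, Nat.cast_pow, Nat.cast_ofNat] at h
    simp only [slice₂]
    rw [e]
    linarith [h]
  have ev₃ : (x ^ n) ^ 2 + 2 * x ^ n * slice₃ F t + slice₃ F (t ^ 2 + 2 * 3 ^ (2 * n))
      ≤ ((4 : ℝ) ^ n + slice₃ F (2 ^ n)) ^ 2 := by
    have h := hF.mono_of_algDegeneratesTo h₃'
    simp only [hF.map_kronecker, hF.map_directSum, hF.map_kroneckerPow,
      soloSpectralPoint_unitTensor hF, Nat.cast_pow, Nat.cast_ofNat] at h
    simp only [slice₃]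
    rw [e]
    linarith [h]
  -- `θ₁ + θ₂ + θ₃ ≥ 2`: the product of the three size-2 slice values is ≥ 4
  have prod_ge : 4 ≤ slice₁ F 2 * slice₂ F 2 * slice₃ F 2 := by
    have h := (four_le_spectralPoint_matMulTensor_two hF).trans
      (hF.mono _ _ (tensorRestrictsTo_sliceProduct_matMulTensor_two ℂ))
    rw [hF.map_kronecker, hF.map_kronecker] at h
    simpa [slice₁, slice₂, slice₃] using h
  have hX : 0 ≤ x ^ n := pow_nonneg hx0 n
  have g₁0 : ∀ m, 0 ≤ slice₁ F m := fun m => hF.nonneg _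
  have g₂0 : ∀ m, 0 ≤ slice₂ F m := fun m => hF.nonneg _
  have g₃0 : ∀ m, 0 ≤ slice₃ F m := fun m => hF.nonneg _
  have g₁2 : slice₁ F 2 ≤ 2 := by simpa [slice₁] using spectralPoint_matMulTensor_le hF 1 2 1
  have g₂2 : slice₂ F 2 ≤ 2 := by simpa [slice₂] using spectralPoint_matMulTensor_le hF 1 1 2
  have g₃2 : slice₃ F 2 ≤ 2 := by simpa [slice₃] using spectralPoint_matMulTensor_le hF 2 1 1
  by_cases c₁ : 4 ≤ slice₁ F 2 ^ 3
  · exact hnum (slice₁ F) g₁0 (fun a L => slice₁_pow hF a L) (fun a b h => slice₁_mono hF h) g₁2 c₁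
      _ hX ev₁
  by_cases c₂ : 4 ≤ slice₂ F 2 ^ 3
  · exact hnum (slice₂ F) g₂0 (fun a L => slice₂_pow hF a L) (fun a b h => slice₂_mono hF h) g₂2 c₂
      _ hX ev₂
  by_cases c₃ : 4 ≤ slice₃ F 2 ^ 3
  · exact hnum (slice₃ F) g₃0 (fun a L => slice₃_pow hF a L) (fun a b h => slice₃_mono hF h) g₃2 c₃
      _ hX ev₃
  exfalso
  push Not at c₁ c₂ c₃
  have p12 : slice₁ F 2 ^ 3 * slice₂ F 2 ^ 3 < 4 * 4 :=
    mul_lt_mul'' c₁ c₂ (pow_nonneg (g₁0 2) 3) (pow_nonneg (g₂0 2) 3)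
  have p123 : slice₁ F 2 ^ 3 * slice₂ F 2 ^ 3 * slice₃ F 2 ^ 3 < 4 * 4 * 4 :=
    mul_lt_mul'' p12 c₃ (mul_nonneg (pow_nonneg (g₁0 2) 3) (pow_nonneg (g₂0 2) 3))
      (pow_nonneg (g₃0 2) 3)
  have p64 : (4 : ℝ) ^ 3 ≤ (slice₁ F 2 * slice₂ F 2 * slice₃ F 2) ^ 3 :=
    pow_le_pow_left₀ (by norm_num) prod_ge 3
  rw [mul_pow, mul_pow] at p64
  linarith

end Scalar

end Summit.MatrixMultiplication.MatrixMultiplication.Theorems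

end
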